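import Summits.Ventures.HSemireg.TwoLevelObstructionAtiyah
import Literature.AlgebraicGeometry.Modules.ExtensionContraction
import HarnessLib

/-!
# Venture HSemireg — THEOREM P for `ob_κ = At ≫ c_κ` with NO contraction hypothesis: the contraction with an
# extension `κ : 0 → 𝒯 → 𝒦 → 𝒪_X → 0` is natural and has its connecting square (construction (c), the last
# functoriality input of the model→sheaf bridge of row 716)

HONEST FRAMING. Lean side of the computation cell `pub-hsemireg` (S4-PUSH, H2 door PAD-4; seat s4-prove-1 g29,
2026-08-28; TIER-3, construction (c5) priced on the cell bus l.32457, director-hodge R13.58).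
`TwoLevelObstructionAtiyah.lean` (p616121) proves THEOREM P both levels and row 716's `LowerColumnSolvable` ∕
`UpperRowSolvable` SHAPES for the composite obstruction `ob(F) = At'(F) ≫ c(F)` of the tree's torsion-safe Atiyah class
with a HYPOTHETICAL natural contraction `c : Contraction X q` plus ONE hypothetical square `hcδ`. Here both hypotheses
are DISCHARGED for the contraction with an extension of the structure sheaf by the tangent sheaf,

  `κ : 0 → 𝒯 →ι 𝒦 →π 𝒪_X → 0`   (`𝒯 = (Ω¹_{X∕k})^∨`; a representative of a class in `Ext¹(𝒪_X, 𝒯) = H¹(X, 𝒯)` —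
  every class has one, the tree's `Literature.Algebra.Homology.Ext.exists_shortExact_extClass_eq`),

using the generic module theory of `Literature/AlgebraicGeometry/Modules/ExtensionContraction.lean` (this seat):
`c_κ(F) := [𝓗om(κ, F)] ∘ ev₁ ∈ Ext¹(𝓗om(𝒯, F), F)` (the class of `0 → 𝓗om(𝒪_X, F) → 𝓗om(𝒦, F) → 𝓗om(𝒯, F) → 0`
transported along `𝓗om(𝒪_X, F) ≅ F`) is natural in `F` (`contractionClass_comp_mk₀`) and satisfies
`[𝓗om(𝒯, S)] ∘ c_κ(E₊) = −c_κ(E) ∘ [S]` for every short exact `S` with `𝓗om(𝒯, S)` short exact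
(`twistExtClass_comp_contractionClass_eq_units_smul`, Cartan–Eilenberg III.4.1). RESULTS:

* `Contraction.ofExtension hκ : Contraction X 1` — a TERM of the structure that was a hypothesis (`c := c_κ`,
  `comm :=` naturality), and `Contraction.ofExtension_hcδ` — its connecting square with `εc = −1`;
* `obExt hκ F := At'(F) ≫ c_κ(F) ∈ Ext²(F, F)` (`= (Contraction.ofExtension hκ).ob`), natural along every module
  map (`obExt_natural`);
* `NaturalAlong.ofExtension` (sign `ε = +1`, `NaturalAlong.ofExtension_ε`), THEOREM P both levels
  (`exists_lower_and_upper_of_extension`), and on a two-level design `0 → ⨁ P →φ ⨁ N → E → 0` row 716's shapes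
  `LowerColumnSolvable` ∕ `UpperRowSolvable` from `obExt hκ E = 0` (`design_lower_and_upper_of_extension`), with the
  ONLY remaining input the short exactness of `𝓗om(𝒯, design sequence)` — itself automatic when `𝒯` is finite
  locally free, e.g. `X → Spec k` smooth (`…_of_isFiniteLocallyFree`).

So the FUNCTORIALITY hypotheses of the bridge sentence «ob_κ(E) = 0 ⇒ 716 `H2` at κ» are now ∅. What remains PAPER:
(B3) the Künneth–Leray frame identifying these `Ext`-groups on the `S⁴` line-bundle designs with row 716's coordinates,
(B4) `ob_κ(L) = κ ∪ c₁(L)` on line bundles, and the comparison of `c_κ` with the classical cup product `κ ∪ –` through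
`𝓗om(𝒯, F) ≅ Ω¹ ⊗ F` (not needed downstream). Generic in the `S`-scheme; no variety, torus or Hodge class is
mentioned; no Literature FACT (`def … : Prop`) is declared or used; no instance, no notation; census-neutral. NOTHING
HERE SAYS THAT HC ∕ HC_CM ∕ HC_AV ∕ W₆ ∕ HC_Kum4Type HOLDS OR FAILS, and nothing here is a statement about
`stub_rung_pad4_seedAt`; `theoremLZeta_holds` stays a theorem of the first-order MODEL.
-/

noncomputable section
namespace Summit.Ventures.HSemireg.TwoLevelObstruction

open CategoryTheory CategoryTheory.Abelian CategoryTheory.Limits AlgebraicGeometry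
open Literature.AlgebraicGeometry.HodgeTheory Literature.AlgebraicGeometry.Modules
  Literature.AlgebraicGeometry.Motives

universe w u

variable {k : Type u} [CommRing k] {X : Over (Spec (CommRingCat.of k))} [HasExt.{w} X.left.Modules]
variable {K : X.left.Modules} {ι : tangentSheaf X ⟶ K} {π : K ⟶ unitModule X.left} {w : ι ≫ π = 0}

/-! ## §1 The contraction with an extension of `𝒪_X` by `𝒯` IS a natural contraction -/

/-- **The contraction with `κ : 0 → 𝒯 → 𝒦 → 𝒪_X → 0`** as a term of `Contraction X 1`: `c(F) := c_κ(F)`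
(`Literature…Modules.contractionClass`), naturality `comm := contractionClass_comp_mk₀`. [construction of this file] -/
def Contraction.ofExtension (hκ : (ShortComplex.mk ι π w).ShortExact) : Contraction.{w} X 1 where
  c F := contractionClass hκ F
  comm f := contractionClass_comp_mk₀ hκ f

/-- Its classes are the `c_κ(F)`. -/
theorem Contraction.ofExtension_c (hκ : (ShortComplex.mk ι π w).ShortExact) (F : X.left.Modules) :
    (Contraction.ofExtension hκ).c F = contractionClass hκ F := rfl

/-- **Its connecting square** (`εc = −1`): for a short exact `S` with `𝓗om(𝒯, S)` short exact,
`[𝓗om(𝒯, S)] ∘ c_κ(E₊) = (−1) • c_κ(E) ∘ [S]` — the hypothesis `hcδ` of `NaturalAlong.ofContraction`, now a theorem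
(`twistExtClass_comp_contractionClass_eq_units_smul`). -/
theorem Contraction.ofExtension_hcδ (hκ : (ShortComplex.mk ι π w).ShortExact) {S : ShortComplex X.left.Modules}
    (hS : S.ShortExact) (hTS : (S.map (sheafHomFunctor (tangentSheaf X))).ShortExact) :
    (twistedExtClass hTS).comp ((Contraction.ofExtension hκ).c S.X₁) (add_comm 1 1) =
      ((-1 : ℤˣ) : ℤ) • ((Contraction.ofExtension hκ).c S.X₃).comp hS.extClass rfl :=
  twistExtClass_comp_contractionClass_eq_units_smul hκ hS hTS _

/-- **`ob_κ(F) := At'(F) ≫ c_κ(F) ∈ Ext²(F, F)`** (stated in every degree `n` with `1 + 1 = n`): the composite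
obstruction of the contraction with `κ`. [definition of this file] -/
abbrev obExt (hκ : (ShortComplex.mk ι π w).ShortExact) {n : ℕ} (h : 1 + 1 = n) (F : X.left.Modules) :
    Ext.{w} F F n :=
  (Contraction.ofExtension hκ).ob h F

/-- `ob_κ` is natural along every module map: `f ≫ ob_κ(G) = ob_κ(F) ≫ f`. -/
theorem obExt_natural (hκ : (ShortComplex.mk ι π w).ShortExact) {n : ℕ} (h : 1 + 1 = n) {F G : X.left.Modules}
    (f : F ⟶ G) :
    (Ext.mk₀ f).comp (obExt hκ h G) (zero_add n) = (obExt hκ h F).comp (Ext.mk₀ f) (add_zero n) :=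
  (Contraction.ofExtension hκ).ob_natural h f

/-! ## §2 One short exact sequence: the datum and THEOREM P, no contraction hypothesis -/

section OneSequence

variable {S : ShortComplex X.left.Modules} {n : ℕ}

/-- **The obstruction datum of `ob_κ` along a short exact `S`** with `𝓗om(𝒯, S)` short exact — every square a
theorem (`atiyahClass'_naturality` ×2, `extClass_comp_atiyahClass'_eq_units_smul`, `contractionClass_comp_mk₀` ×2,
`twistExtClass_comp_contractionClass_eq_units_smul`). [construction of this file] -/
def NaturalAlong.ofExtension (hκ : (ShortComplex.mk ι π w).ShortExact) (hS : S.ShortExact)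
    (hTS : (S.map (sheafHomFunctor (tangentSheaf X))).ShortExact) (h : 1 + 1 = n) : NaturalAlong hS n :=
  NaturalAlong.ofContraction hS hTS (Contraction.ofExtension hκ) h (-1) (Contraction.ofExtension_hcδ hκ hS hTS)

/-- Its three obstructions are `ob_κ(E₊), ob_κ(E₋), ob_κ(E)`. -/
theorem NaturalAlong.ofExtension_ω (hκ : (ShortComplex.mk ι π w).ShortExact) (hS : S.ShortExact)
    (hTS : (S.map (sheafHomFunctor (tangentSheaf X))).ShortExact) (h : 1 + 1 = n) :
    (NaturalAlong.ofExtension hκ hS hTS h).ω₁ = obExt hκ h S.X₁ ∧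
      (NaturalAlong.ofExtension hκ hS hTS h).ω₂ = obExt hκ h S.X₂ ∧
        (NaturalAlong.ofExtension hκ hS hTS h).ω₃ = obExt hκ h S.X₃ :=
  ⟨rfl, rfl, rfl⟩

/-- **Its sign is `+1`**: `[S] ∘ ob_κ(E₊) = ob_κ(E) ∘ [S]` (the two signs `−1` of the Atiyah square and of the
contraction square cancel). -/
theorem NaturalAlong.ofExtension_ε (hκ : (ShortComplex.mk ι π w).ShortExact) (hS : S.ShortExact)
    (hTS : (S.map (sheafHomFunctor (tangentSheaf X))).ShortExact) (h : 1 + 1 = n) :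
    (NaturalAlong.ofExtension hκ hS hTS h).ε = 1 := by
  rw [NaturalAlong.ofExtension, NaturalAlong.ofContraction_ε, neg_neg]

/-- `ob_κ` commutes with the connecting class: `[S] ∘ ob_κ(E₊) = ob_κ(E) ∘ [S]` in `Ext³`-free form
(`Ext^{1+n}(E, E₊)`). -/
theorem extClass_comp_obExt (hκ : (ShortComplex.mk ι π w).ShortExact) (hS : S.ShortExact)
    (hTS : (S.map (sheafHomFunctor (tangentSheaf X))).ShortExact) (h : 1 + 1 = n) :
    hS.extClass.comp (obExt hκ h S.X₁) (add_comm 1 n) = (obExt hκ h S.X₃).comp hS.extClass rfl := by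
  have e := (NaturalAlong.ofExtension hκ hS hTS h).comm_δ
  rw [NaturalAlong.ofExtension_ε, Units.val_one, one_zsmul] at e
  exact e

/-- **THEOREM P, both levels, for `ob_κ` — NO contraction hypothesis**: if `ob_κ(E) = 0` then `ob_κ(E₋)` factors
through the presentation (`∃ η, η ∘ f = ob_κ(E₋)`) and `ob_κ(E₊)` lifts (`∃ η′, f ∘ η′ = ob_κ(E₊)`); only input
beyond the tree's theorems: `𝓗om(𝒯, S)` short exact. -/
theorem exists_lower_and_upper_of_extension (hκ : (ShortComplex.mk ι π w).ShortExact) (hS : S.ShortExact)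
    (hTS : (S.map (sheafHomFunctor (tangentSheaf X))).ShortExact) (h : 1 + 1 = n)
    (h0 : obExt hκ h S.X₃ = 0) :
    (∃ η : Ext S.X₂ S.X₁ n, η.comp (Ext.mk₀ S.f) (add_zero n) = obExt hκ h S.X₂) ∧
      ∃ η' : Ext S.X₂ S.X₁ n, (Ext.mk₀ S.f).comp η' (zero_add n) = obExt hκ h S.X₁ :=
  (NaturalAlong.ofExtension hκ hS hTS h).exists_lower_and_upper h0

/-- **THEOREM P, both levels, for `ob_κ`, `𝒯` finite locally free** (e.g. `X → Spec k` smooth): unconditional in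
`S`. -/
theorem exists_lower_and_upper_of_extension_of_isFiniteLocallyFree (hκ : (ShortComplex.mk ι π w).ShortExact)
    (hS : S.ShortExact) (h𝒯 : IsFiniteLocallyFree (tangentSheaf X)) (h : 1 + 1 = n)
    (h0 : obExt hκ h S.X₃ = 0) :
    (∃ η : Ext S.X₂ S.X₁ n, η.comp (Ext.mk₀ S.f) (add_zero n) = obExt hκ h S.X₂) ∧
      ∃ η' : Ext S.X₂ S.X₁ n, (Ext.mk₀ S.f).comp η' (zero_add n) = obExt hκ h S.X₁ :=
  exists_lower_and_upper_of_extension hκ hS (shortExact_map_sheafHomFunctor_tangentSheaf hS h𝒯) h h0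

end OneSequence

/-! ## §3 Two-level designs: row 716's shapes from `ob_κ(E) = 0`, no contraction hypothesis -/

section TwoLevel

variable [HasFiniteBiproducts X.left.Modules]
variable {I J : Type} [Fintype I] [Fintype J]
variable {N : I → X.left.Modules} {P : J → X.left.Modules} {E : X.left.Modules} {n : ℕ}
variable {φ : ⨁ P ⟶ ⨁ N} {g : ⨁ N ⟶ E} {wφ : φ ≫ g = 0}

/-- **The obstruction datum of `ob_κ` on a two-level design** `0 → ⨁ P →φ ⨁ N →g E → 0` with `𝓗om(𝒯, –)` of it
short exact: every square a theorem. [construction of this file] -/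
def OnDesign.ofExtension (hκ : (ShortComplex.mk ι π w).ShortExact) (hS : (ShortComplex.mk φ g wφ).ShortExact)
    (hTS : ((ShortComplex.mk φ g wφ).map (sheafHomFunctor (tangentSheaf X))).ShortExact) (h : 1 + 1 = n) :
    OnDesign hS n :=
  OnDesign.ofContraction hS hTS (Contraction.ofExtension hκ) h (-1) (Contraction.ofExtension_hcδ hκ hS hTS)

/-- **Row 716's `Design.H2` SHAPE at one direction is NECESSARY for `ob_κ(E) = 0` — functoriality inputs ∅**: for
an extension `κ : 0 → 𝒯 → 𝒦 → 𝒪_X → 0` and a two-level design `0 → ⨁ P →φ ⨁ N → E → 0` whose twist by `𝓗om(𝒯, –)`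
is short exact, `ob_κ(E) = At'(E) ≫ c_κ(E) = 0` implies — for every column `N i`: `∃ η_j ∈ Extⁿ(N i, P j)` with
`Σ_j η_j ∘ φ_{ij} = ob_κ(N i)` and `Σ_j η_j ∘ φ_{rj} = 0` (`r ≠ i`); and for every row object `P j`: `∃ η′_i` with
`Σ_i φ_{ij} ∘ η′_i = ob_κ(P j)` and `Σ_i φ_{is} ∘ η′_i = 0` (`s ≠ j`). Still PAPER for the bridge: the
Künneth–Leray frame (B3) and `ob_κ` on line bundles (B4). -/
theorem design_lower_and_upper_of_extension (hκ : (ShortComplex.mk ι π w).ShortExact)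
    (hS : (ShortComplex.mk φ g wφ).ShortExact)
    (hTS : ((ShortComplex.mk φ g wφ).map (sheafHomFunctor (tangentSheaf X))).ShortExact) (h : 1 + 1 = n)
    (h0 : obExt hκ h E = 0) :
    (∀ i, ∃ η : ∀ j, Ext (N i) (P j) n,
      (∑ j, (η j).comp (Ext.mk₀ (entry φ i j)) (add_zero n) = obExt hκ h (N i)) ∧
        ∀ r, i ≠ r → ∑ j, (η j).comp (Ext.mk₀ (entry φ r j)) (add_zero n) = 0) ∧
    ∀ j, ∃ η' : ∀ i, Ext (N i) (P j) n,
      (∑ i, (Ext.mk₀ (entry φ i j)).comp (η' i) (zero_add n) = obExt hκ h (P j)) ∧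
        ∀ s, s ≠ j → ∑ i, (Ext.mk₀ (entry φ i s)).comp (η' i) (zero_add n) = 0 :=
  (OnDesign.ofExtension hκ hS hTS h).lower_and_upper h0

/-- **The same for `𝒯` finite locally free** (e.g. `X → Spec k` smooth): the ONLY hypotheses are the extension `κ`,
the design sequence being short exact, and `ob_κ(E) = 0`. -/
theorem design_lower_and_upper_of_extension_of_isFiniteLocallyFree (hκ : (ShortComplex.mk ι π w).ShortExact)
    (hS : (ShortComplex.mk φ g wφ).ShortExact) (h𝒯 : IsFiniteLocallyFree (tangentSheaf X)) (h : 1 + 1 = n)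
    (h0 : obExt hκ h E = 0) :
    (∀ i, ∃ η : ∀ j, Ext (N i) (P j) n,
      (∑ j, (η j).comp (Ext.mk₀ (entry φ i j)) (add_zero n) = obExt hκ h (N i)) ∧
        ∀ r, i ≠ r → ∑ j, (η j).comp (Ext.mk₀ (entry φ r j)) (add_zero n) = 0) ∧
    ∀ j, ∃ η' : ∀ i, Ext (N i) (P j) n,
      (∑ i, (Ext.mk₀ (entry φ i j)).comp (η' i) (zero_add n) = obExt hκ h (P j)) ∧
        ∀ s, s ≠ j → ∑ i, (Ext.mk₀ (entry φ i s)).comp (η' i) (zero_add n) = 0 :=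
  design_lower_and_upper_of_extension hκ hS (shortExact_map_sheafHomFunctor_tangentSheaf hS h𝒯) h h0

end TwoLevel

end Summit.Ventures.HSemireg.TwoLevelObstruction

end
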